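import Literature.AlgebraicGeometry.Motives.HodgeStructureEndAlgCentralizerInvolutionMatrixPairs
import Literature.RingTheory.SimpleModule.InvolutionUnitaryGeneration
import HarnessLib

/-!
# Milne 1999 §3, opening of the proof of Prop. 3.3 on points: "the `k`-algebra `C(A)` is generated by the
# `γ ∈ S(A)(k)`" — `C(H)(K) = K[S(H)(K)]` for `E_φ` simple with centre a CM-type field (the pairs case)

[topic AlgebraicGeometry/Motives]

Layer `Literature/AlgebraicGeometry/Motives`, lane `lit-hodgefound` (Track 2 foundations library; seat `lit-hodgefound-p34`,
generation 23, row g23-#5), namespace `Literature.AlgebraicGeometry.Motives.HodgeStructure`. The sequel of g23-#2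
(`HodgeStructureEndAlgCentralizerInvolutionMatrixPairs`: `Ψ : C(H)(K) ≃ₐ[K] Π_{s ∈ Φ} (M_m(K) × M_m(K))` with
`Ψ(c†)ₛ = ((Ψ c)ₛ.2ᵀ, (Ψ c)ₛ.1ᵀ)`) and of g23-#4 (`Literature/RingTheory/SimpleModule/InvolutionUnitaryGeneration`: Milne's
Lemma 3.5 for the model pairs — `Π_s (M_m(K) × M_m(K))` with `(α, β)† = (βᵗʳ, αᵗʳ)` is generated by its unitary elements).
THEOREMS ONLY — no definition, no named fact, no `sorry` (D-0026, net debt 0).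

## The source, verbatim

J. S. Milne, *Lefschetz classes on abelian varieties*, Duke Math. J. 96 (1999), §3 p. 653 L37–L46 (held text
`paper:doi-10-1215-s0012-7094-99-09620-5`, p0015): "because `γ†γ = 1` for `γ ∈ S(A)(k)`, `ψ` is invariant under `S(A)`
if and only if `ψ ∘ (γ × 1) = ψ ∘ (1 × γ†)`, all `γ ∈ S(A)(k)`. The next lemma shows that the `k`-algebra `C(A)` is
generated by the `γ ∈ S(A)(k)`, and so Proposition 3.3 follows from Proposition 1.3. **Lemma 3.5.** Any semisimple
algebra with involution `(R, †)` of finite dimension over an algebraically closed field `k` is generated (as a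
`k`-algebra) by the subset `U` of elements `u` satisfying `u†u = 1`."; §1 p. 644 L16–L20: "`S(A)(R) = {γ ∈ C(A) ⊗_k R |
γ†γ = 1}`"; §2 p. 651 L5–L8 and L57–L70 (type IV): "`(α, β)† = (βᵗʳ, αᵗʳ)` … `C(A) ⊗_k k^al = Π C_σ` where
`C_σ ≈ End_Ē(V̄) ≈ M_{g/fd}(k^al) × M_{g/fd}(k^al)`".

## Statement (on `K`-points, as g22/g23)

`(H, Q)` a polarized `ℚ`-Hodge structure with `A : EndAction H F` (`ι : F → E_φ` central), `σ` an involution of `F` with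
the Rosati condition `Q(ι(a)v, w) = Q(v, ι(σa)w)`, `K ⊇ ℚ` a field containing all `[F:ℚ]` embeddings `τ : S ↪ (F →ₐ K)`,
`κ` the partner map `τ (κ s) = τ s ∘ σ`, `Φ` a set of representatives of the pairs `{s, κ s}` (so `σ ≠ 1` on `F`:
the CM / "pairs" case), `C(H)(K) = Subalgebra.centralizer K {a_K | a ∈ E_φ}` and `S(H)(K) = Q.lefschetzGroupBaseChange K`.

* §1 (any field `K ⊇ ℚ`, no `A`): `Polarization.coe_mem_centralizer_of_mem_lefschetzGroupBaseChange` (`S(H)(K) ⊆ C(H)(K)`),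
  `Polarization.centralizerAdjoint_mul_self_eq_one_iff` (`c†c = 1` in `C(H)(K)` iff in `End_K(K ⊗ V)`),
  `Polarization.exists_mem_lefschetzGroupBaseChange_coe_eq` (a `c ∈ C(H)(K)` with `c†c = 1` IS an element of `S(H)(K)`:
  `c† = c⁻¹` by finite dimension), `Polarization.image_coe_lefschetzGroupBaseChange_eq` ("`S(A)(K) = {γ ∈ C(A) ⊗ K |
  γ†γ = 1}`" as an equality of subsets of `End_K(K ⊗ V)`), `Polarization.adjoin_coe_lefschetzGroupBaseChange_le`
  (`K[S(H)(K)] ⊆ C(H)(K)`).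
* §2 (`K` algebraically closed, `E_φ` simple with centre `ι(F)`, pairs case):
  **`Polarization.adjoin_setOf_centralizerAdjoint_mul_self_eq_one_eq_top`** — `(C(H)(K), †)` is generated by its unitary
  elements (transport of g23-#4's `adjoin_pi_setOf_swapTranspose_mul_self_eq_one_eq_top` along g23-#2's `Ψ`), and
  **`Polarization.adjoin_coe_lefschetzGroupBaseChange_eq_centralizer`** — "the `k`-algebra `C(A)` is generated by the
  `γ ∈ S(A)(k)`": `K[S(H)(K)] = C(H)(K)`.

NOT here (honest scope): the case `σ = 1` on `F` (types I/II/III: one block per embedding with a symmetric / alternating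
form — g23-#4 has the model statements `adjoin_isometries_eq_top_of_isSymm/_of_isAlt`, but the `†`-compatible algebra
equivalence `C(H)(K) ≃ Π_s End(V_{K,s})` with `†ₛ` the `B_s`-adjoint on CORNERS needs form-compatible splittings, not in the
tree); non-simple `E_φ` (product over the simple factors); the descent from `K = k^al` to `k` (Milne's Lemma 3.1).

## References
* [Milne1999LefschetzClasses] J. S. Milne, *Lefschetz classes on abelian varieties*, Duke Math. J. 96 (1999),
  §1 p. 644, §2 p. 651, §3 p. 653 (proof of Prop. 3.3, Lemma 3.5).
-/

noncomputable section

open scoped TensorProduct Matrix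
open Function Module

namespace Literature.AlgebraicGeometry.Motives

namespace HodgeStructure

universe u uK

variable {V : Type u} [AddCommGroup V] [Module ℚ V] {n : ℤ} {H : HodgeStructure V n}
variable (K : Type uK) [Field K] [Algebra ℚ K] (Q : Polarization H) [Module.Finite ℚ V]

/-! ### §1 `S(H)(K) = {c ∈ C(H)(K) | c†c = 1}` inside `End_K(K ⊗ V)` -/

section Unitary

omit [Module.Finite ℚ V] in
/-- **`S(H)(K) ⊆ C(H)(K)`**: an element of `S(H)(K)` commutes with every `a_K`, `a ∈ E_φ`, i.e. lies in the centralizer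
subalgebra `C(H)(K) = C(E_φ ⊗ K)` ("`S(A)(R) = {γ ∈ C(A) ⊗_k R | …}`"). [cite: Milne1999LefschetzClasses, §1 p. 644 L16–L20] -/
theorem Polarization.coe_mem_centralizer_of_mem_lefschetzGroupBaseChange {γ : (K ⊗[ℚ] V) ≃ₗ[K] (K ⊗[ℚ] V)}
    (hγ : γ ∈ Q.lefschetzGroupBaseChange K) :
    (γ : Module.End K (K ⊗[ℚ] V)) ∈
      Subalgebra.centralizer K ((fun a : Module.End ℚ V => a.baseChange K) '' (H.endAlg : Set (Module.End ℚ V))) := by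
  rw [Subalgebra.mem_centralizer_iff]
  rintro _ ⟨a, ha, rfl⟩
  exact LinearMap.ext fun x ↦ hγ.1 ⟨a, ha⟩ x

/-- `c†c = 1` in the subalgebra `C(H)(K)` iff `c†c = 1` in `End_K(K ⊗ V)`. [cite: Milne1999LefschetzClasses, §1 p. 644 L16–L20] -/
theorem Polarization.centralizerAdjoint_mul_self_eq_one_iff
    (c : Subalgebra.centralizer K ((fun a : Module.End ℚ V => a.baseChange K) '' (H.endAlg : Set (Module.End ℚ V)))) :
    Q.centralizerAdjoint K c * c = 1 ↔
      Q.adjointBaseChange K (c : Module.End K (K ⊗[ℚ] V)) * (c : Module.End K (K ⊗[ℚ] V)) = 1 := by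
  rw [Subtype.ext_iff, Subalgebra.coe_mul, Polarization.coe_centralizerAdjoint, Subalgebra.coe_one]

/-- **A unitary element of `C(H)(K)` is an element of `S(H)(K)`**: if `c ∈ C(H)(K)` satisfies `c†c = 1` then `c` is
invertible (`K ⊗ V` is finite-dimensional, so `cc† = 1` too) and the automorphism `c` lies in `S(H)(K)`
("`S(A)(R) = {γ ∈ C(A) ⊗_k R | γ†γ = 1}`"). [cite: Milne1999LefschetzClasses, §1 p. 644 L16–L20] -/
theorem Polarization.exists_mem_lefschetzGroupBaseChange_coe_eq
    {c : Subalgebra.centralizer K ((fun a : Module.End ℚ V => a.baseChange K) '' (H.endAlg : Set (Module.End ℚ V)))}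
    (hc : Q.centralizerAdjoint K c * c = 1) :
    ∃ γ ∈ Q.lefschetzGroupBaseChange K, (γ : Module.End K (K ⊗[ℚ] V)) = c := by
  rw [Polarization.centralizerAdjoint_mul_self_eq_one_iff] at hc
  have hc' : (c : Module.End K (K ⊗[ℚ] V)) * Q.adjointBaseChange K (c : Module.End K (K ⊗[ℚ] V)) = 1 :=
    mul_eq_one_comm.1 hc
  let γ : (K ⊗[ℚ] V) ≃ₗ[K] (K ⊗[ℚ] V) :=
    LinearEquiv.ofLinear (c : Module.End K (K ⊗[ℚ] V)) (Q.adjointBaseChange K (c : Module.End K (K ⊗[ℚ] V))) hc' hc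
  have hγc : (γ : Module.End K (K ⊗[ℚ] V)) = c := rfl
  refine ⟨γ, ?_, hγc⟩
  rw [Q.mem_lefschetzGroupBaseChange_iff_adjointBaseChange_mul_self_eq_one K γ, hγc]
  refine ⟨fun a x ↦ ?_, hc⟩
  change ((a : Module.End ℚ V).baseChange K * (c : Module.End K (K ⊗[ℚ] V))) x =
    ((c : Module.End K (K ⊗[ℚ] V)) * (a : Module.End ℚ V).baseChange K) x
  rw [baseChange_mul_eq_of_mem_centralizer K c.2 a.2]

/-- **"`S(A)(K) = {γ ∈ C(A) ⊗ K | γ†γ = 1}`" as subsets of `End_K(K ⊗ V)`**: the underlying endomorphisms of `S(H)(K)` are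
exactly the underlying endomorphisms of the unitary elements of `(C(H)(K), †)`. [cite: Milne1999LefschetzClasses, §1 p. 644 L16–L20] -/
theorem Polarization.image_coe_lefschetzGroupBaseChange_eq :
    (fun γ : (K ⊗[ℚ] V) ≃ₗ[K] (K ⊗[ℚ] V) => (γ : Module.End K (K ⊗[ℚ] V))) '' (Q.lefschetzGroupBaseChange K : Set _) =
      Subtype.val '' {c : Subalgebra.centralizer K ((fun a : Module.End ℚ V => a.baseChange K) ''
        (H.endAlg : Set (Module.End ℚ V))) | Q.centralizerAdjoint K c * c = 1} := by
  ext f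
  constructor
  · rintro ⟨γ, hγ, rfl⟩
    refine ⟨⟨γ, Q.coe_mem_centralizer_of_mem_lefschetzGroupBaseChange K hγ⟩, ?_, rfl⟩
    rw [Set.mem_setOf_eq, Polarization.centralizerAdjoint_mul_self_eq_one_iff]
    exact ((Q.mem_lefschetzGroupBaseChange_iff_adjointBaseChange_mul_self_eq_one K γ).1 hγ).2
  · rintro ⟨c, hc, rfl⟩
    obtain ⟨γ, hγ, hγc⟩ := Q.exists_mem_lefschetzGroupBaseChange_coe_eq K hc
    exact ⟨γ, hγ, hγc⟩

omit [Module.Finite ℚ V] in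
/-- **`K[S(H)(K)] ⊆ C(H)(K)`** (any field `K ⊇ ℚ`). [cite: Milne1999LefschetzClasses, §1 p. 644 L16–L20 and §3 p. 653 L42–L43] -/
theorem Polarization.adjoin_coe_lefschetzGroupBaseChange_le :
    Algebra.adjoin K ((fun γ : (K ⊗[ℚ] V) ≃ₗ[K] (K ⊗[ℚ] V) => (γ : Module.End K (K ⊗[ℚ] V))) ''
        (Q.lefschetzGroupBaseChange K : Set _)) ≤
      Subalgebra.centralizer K ((fun a : Module.End ℚ V => a.baseChange K) '' (H.endAlg : Set (Module.End ℚ V))) := by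
  refine Algebra.adjoin_le ?_
  rintro _ ⟨γ, hγ, rfl⟩
  exact Q.coe_mem_centralizer_of_mem_lefschetzGroupBaseChange K hγ

end Unitary

/-! ### §2 The pairs case over an algebraically closed field: `C(H)(K) = K[S(H)(K)]` -/

section Pairs

variable {F : Type*} [Field F] [NumberField F]
variable (A : EndAction H F) {S : Type*} (τ : S → (F →ₐ[ℚ] K)) (σ : F ≃ₐ[ℚ] F)
variable [Fintype S] (κ : S → S) (Φ : Finset S)
variable (hτ : Injective τ) (hcard : Fintype.card S = finrank ℚ F)
  (hros : ∀ a v w, Q.form (A.ι a v) w = Q.form v (A.ι (σ a) w)) (hσ : ∀ a, σ (σ a) = a)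
  (hκ : ∀ s, τ (κ s) = (τ s).comp (σ : F →ₐ[ℚ] F))
  (hΦ₁ : ∀ s, s ∈ Φ ∨ κ s ∈ Φ) (hΦ₂ : ∀ s ∈ Φ, κ s ∉ Φ)
  (hcent : ∀ a ∈ H.endAlg, ∀ f : F, a * A.ι f = A.ι f * a)

include A τ σ κ Φ hτ hcard hros hσ hκ hΦ₁ hΦ₂ hcent in
/-- **Milne's Lemma 3.5 for `(C(H)(K), †)` in the pairs case: `C(H)(K)` is generated as a `K`-algebra by its unitary
elements `{c | c†c = 1}`** — `E_φ` simple with centre the central field `ι(F)`, Rosati condition for the involution `σ ≠ 1`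
of `F`, `K` algebraically closed containing all embeddings of `F`: transport of the model statement for
`Π_{s ∈ Φ} (M_m(K) × M_m(K))`, `(α, β)† = (βᵗʳ, αᵗʳ)` (g23-#4) along the `†`-compatible algebra equivalence `Ψ` of g23-#2.
[cite: Milne1999LefschetzClasses, §3 Lemma 3.5 (p. 653 L44–L46) with §2 p. 651 L5–L8, L57–L70] -/
theorem Polarization.adjoin_setOf_centralizerAdjoint_mul_self_eq_one_eq_top [IsAlgClosed K] [IsSimpleRing H.endAlg]
    (hcen : ∀ z ∈ H.endAlg, (∀ a ∈ H.endAlg, a * z = z * a) → z ∈ Set.range A.ι) :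
    Algebra.adjoin K {c : Subalgebra.centralizer K ((fun a : Module.End ℚ V => a.baseChange K) ''
      (H.endAlg : Set (Module.End ℚ V))) | Q.centralizerAdjoint K c * c = 1} = ⊤ := by
  classical
  obtain ⟨d, _, _, _, Ψ, hΨ⟩ :=
    Q.exists_centralizer_algEquiv_matrixPairs_adjoint K A τ σ κ Φ hτ hcard hros hσ hκ hΦ₁ hΦ₂ hcent hcen
  set U := {c : Subalgebra.centralizer K ((fun a : Module.End ℚ V => a.baseChange K) ''
      (H.endAlg : Set (Module.End ℚ V))) | Q.centralizerAdjoint K c * c = 1} with hU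
  -- `2 ≠ 0` in the `ℚ`-algebra `K`
  have h2 : (2 : K) ≠ 0 := by
    rw [show (2 : K) = algebraMap ℚ K 2 by norm_num]
    exact (map_ne_zero (algebraMap ℚ K)).2 two_ne_zero
  -- `Ψ` carries the unitary elements of `C(H)(K)` onto the unitary families of the model pair
  have himage : (Ψ : _ → _) '' U =
      {x : Φ → Matrix (Fin (finrank ℚ V / finrank ℚ F / d)) (Fin (finrank ℚ V / finrank ℚ F / d)) K ×
          Matrix (Fin (finrank ℚ V / finrank ℚ F / d)) (Fin (finrank ℚ V / finrank ℚ F / d)) K |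
        ∀ s, Literature.RingTheory.SimpleModule.swapTranspose (x s) * x s = 1} := by
    have key : ∀ c, c ∈ U ↔ ∀ s, Literature.RingTheory.SimpleModule.swapTranspose (Ψ c s) * Ψ c s = 1 := by
      intro c
      rw [hU, Set.mem_setOf_eq, ← Ψ.injective.eq_iff, map_mul, map_one, funext_iff]
      refine forall_congr' fun s ↦ ?_
      rw [Pi.mul_apply, Pi.one_apply, hΨ c s, Literature.RingTheory.SimpleModule.swapTranspose_apply]
    ext x
    constructor
    · rintro ⟨c, hc, rfl⟩
      exact (key c).1 hc
    · intro hx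
      refine ⟨Ψ.symm x, (key _).2 ?_, Ψ.apply_symm_apply x⟩
      simpa only [Ψ.apply_symm_apply, Set.mem_setOf_eq] using hx
  have hmap : (Algebra.adjoin K U).map Ψ.toAlgHom = ⊤ := by
    rw [AlgHom.map_adjoin]
    change Algebra.adjoin K ((Ψ : _ → _) '' U) = ⊤
    rw [himage]
    exact Literature.RingTheory.SimpleModule.adjoin_pi_setOf_swapTranspose_mul_self_eq_one_eq_top h2
  refine eq_top_iff.2 fun c _ ↦ ?_
  have hc : Ψ.toAlgHom c ∈ (Algebra.adjoin K U).map Ψ.toAlgHom := hmap ▸ Algebra.mem_top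
  obtain ⟨c', hc', hcc'⟩ := Subalgebra.mem_map.1 hc
  have hc'c : c' = c := Ψ.injective hcc'
  exact hc'c ▸ hc'

include A τ σ κ Φ hτ hcard hros hσ hκ hΦ₁ hΦ₂ hcent in
/-- **"The `k`-algebra `C(A)` is generated by the `γ ∈ S(A)(k)`" on `K`-points, pairs case: `K[S(H)(K)] = C(H)(K)`** —
the `K`-subalgebra of `End_K(K ⊗ V)` generated by (the underlying endomorphisms of) the Lefschetz group `S(H)(K)` is the whole
centralizer `C(H)(K)` of `E_φ ⊗ K` (`E_φ` simple with centre `ι(F)`, `σ ≠ 1` on `F` with the Rosati condition, `K` algebraically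
closed containing all embeddings of `F`). [cite: Milne1999LefschetzClasses, §3 p. 653 L42–L46 (proof of Prop. 3.3 via Lemma 3.5)] -/
theorem Polarization.adjoin_coe_lefschetzGroupBaseChange_eq_centralizer [IsAlgClosed K] [IsSimpleRing H.endAlg]
    (hcen : ∀ z ∈ H.endAlg, (∀ a ∈ H.endAlg, a * z = z * a) → z ∈ Set.range A.ι) :
    Algebra.adjoin K ((fun γ : (K ⊗[ℚ] V) ≃ₗ[K] (K ⊗[ℚ] V) => (γ : Module.End K (K ⊗[ℚ] V))) ''
        (Q.lefschetzGroupBaseChange K : Set _)) =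
      Subalgebra.centralizer K ((fun a : Module.End ℚ V => a.baseChange K) '' (H.endAlg : Set (Module.End ℚ V))) := by
  refine le_antisymm (Q.adjoin_coe_lefschetzGroupBaseChange_le K) ?_
  -- `C(H)(K) = val (K[U]) = K[val U] ⊆ K[S(H)(K)]`
  set C := Subalgebra.centralizer K ((fun a : Module.End ℚ V => a.baseChange K) '' (H.endAlg : Set (Module.End ℚ V)))
  have htop := Q.adjoin_setOf_centralizerAdjoint_mul_self_eq_one_eq_top K A τ σ κ Φ hτ hcard hros hσ hκ hΦ₁ hΦ₂ hcent hcen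
  have hval : (Algebra.adjoin K {c : C | Q.centralizerAdjoint K c * c = 1}).map C.val =
      Algebra.adjoin K (Subtype.val '' {c : C | Q.centralizerAdjoint K c * c = 1}) := AlgHom.map_adjoin _ _
  rw [htop, Algebra.map_top, Subalgebra.range_val, ← Q.image_coe_lefschetzGroupBaseChange_eq K] at hval
  exact hval.le

end Pairs

end HodgeStructure

end Literature.AlgebraicGeometry.Motives

end
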